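import Summits.CriticalPhenomena.Ising3DConformalLimit.Theorems.EnergyNotSigmaSquaredMoebiusLimitExistsDefs
import Literature.Probability.LatticeModels.CriticalScalingDimension

/-!
# `MoebiusLimit` (item stmt-CriticalPhenomena-1344), line `only-interaction-breaks-moebius`:
# STUBS 5 and 6 are false without the lattice (`IsClusterPoint` is load-bearing)

Negative knowledge for the picked line of the crux (standing crux disprover gen 3, D-0016);
THEOREM-ONLY. `stub_interactingInversion` and `stub_interactingUnique` quantify over REGULAR CLUSTER
POINTS of the pinned zoom with pure-power two-point function. Dropping the hypothesis
`IsClusterPoint` (the only place where the `ℤ³` correlators enter) makes both false, with explicit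
regular families: `S₂ := ‖x−y‖⁻²` (normalised), `S₄ := a·𝟙_{NonCoincident}`, all other `S_n := 0`
(`S₀ := 1`). Then `U₄ = 1 − Σ pp ≢ 0` for `a = 1` (at `(0,2e₀,4e₀,6e₀)` the pairing sum is `≤ 3/16`),
inversion covariance with `Δ = 1` fails at `(e₀,2e₀,4e₀,8e₀)` (`S₄(ιx) ≤ 1 < 4096 = ∏‖xᵢ‖²·S₄(x)`),
and the families `a = 1`, `a = 2` share `S₂` but differ at `n = 4`. So any proof of STUBS 5–6 must use
the lattice sequence defining the cluster point (consistent with the barrier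
`ScaleCovarianceNotMoebius`: no closed pointwise constraint on an abstract family yields inversion
covariance or uniqueness).
* `interactingInversion_false_without_clusterPoint`, `interactingUnique_false_without_clusterPoint`.
-/

noncomputable section

namespace Summit.CriticalPhenomena.Ising3DConformalLimit.MoebiusLimitExistsNegative

open Literature.Probability.LatticeModels Filter Set
open Summit.CriticalPhenomena.Ising3DConformalLimit.MoebiusLimitExistsOnlyInteraction
open scoped Topology

/-! ### The witness families -/

/-- The abstract REGULAR families `F_a`: `S₀ = 1`, `S₂ = ‖x−y‖⁻²` and `S₄ = a` on `NonCoincident`, zero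
elsewhere and at all other orders (an existence statement; no definition is introduced). [folklore] -/
theorem exists_regular_powerTwo_family (a : ℝ) :
    ∃ S : CorrFamily 3, MoebiusLimitExistsOnlyInteraction.IsRegular S ∧
      (∀ x ∈ NonCoincident 3 2, S 2 x = ‖x 0 - x 1‖ ^ (-(2 * (1:ℝ)))) ∧
      (∀ x ∈ NonCoincident 3 4, S 4 x = a) := by
  classical
  let S2 : (Fin 2 → EuclideanSpace ℝ (Fin 3)) → ℝ := fun x =>
    if x ∈ NonCoincident 3 2 then ‖x 0 - x 1‖ ^ (-(2 * (1:ℝ))) else 0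
  let S4 : (Fin 4 → EuclideanSpace ℝ (Fin 3)) → ℝ := fun x => if x ∈ NonCoincident 3 4 then a else 0
  let S : CorrFamily 3 := fun n => match n with
    | 0 => fun _ => 1
    | 2 => S2
    | 4 => S4
    | _ => fun _ => 0
  have hS2 : ∀ x, S 2 x = S2 x := fun x => rfl
  have hS4 : ∀ x, S 4 x = S4 x := fun x => rfl
  have hSother : ∀ n, n ≠ 0 → n ≠ 2 → n ≠ 4 → ∀ x, S n x = 0 := by
    intro n h0 h2 h4 x
    match n, h0, h2, h4 with
    | 0, h0, _, _ => exact absurd rfl h0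
    | 1, _, _, _ => rfl
    | 2, _, h2, _ => exact absurd rfl h2
    | 3, _, _, _ => rfl
    | 4, _, _, h4 => exact absurd rfl h4
    | _ + 5, _, _, _ => rfl
  have hmem : ∀ {n : ℕ} (v : EuclideanSpace ℝ (Fin 3)) (x : Fin n → EuclideanSpace ℝ (Fin 3)),
      ((fun i => x i + v) ∈ NonCoincident 3 n) ↔ x ∈ NonCoincident 3 n := by
    intro n v x
    rw [mem_nonCoincident, mem_nonCoincident]
    exact (add_left_injective v).of_comp_iff x
  refine ⟨S, ⟨?_, ?_, ?_⟩, fun x hx => ?_, fun x hx => ?_⟩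
  · -- normalised
    intro n x hx
    by_cases h0 : n = 0
    · subst h0
      exfalso; apply hx; rw [mem_nonCoincident]; intro i; exact Fin.elim0 i
    by_cases h2 : n = 2
    · subst h2; rw [hS2]; simp only [S2, hx, ↓reduceIte]
    by_cases h4 : n = 4
    · subst h4; rw [hS4]; simp only [S4, hx, ↓reduceIte]
    exact hSother n h0 h2 h4 x
  · -- continuous off the diagonals
    intro n
    by_cases h0 : n = 0
    · subst h0; exact continuousOn_const.congr fun x _ => rfl
    by_cases h2 : n = 2
    · subst h2
      have hcont : ContinuousOn (fun x : Fin 2 → EuclideanSpace ℝ (Fin 3) => ‖x 0 - x 1‖ ^ (-(2 * (1:ℝ))))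
          (NonCoincident 3 2) := by
        intro x hx
        have hne : ‖x 0 - x 1‖ ≠ 0 := by
          rw [norm_ne_zero_iff, sub_ne_zero]
          exact ((mem_nonCoincident x).1 hx).ne (by decide)
        refine ContinuousAt.continuousWithinAt ?_
        have h1 : ContinuousAt (fun y : Fin 2 → EuclideanSpace ℝ (Fin 3) => ‖y 0 - y 1‖) x :=
          ((continuous_apply 0).sub (continuous_apply 1)).norm.continuousAt
        exact h1.rpow_const (Or.inl hne)
      refine hcont.congr fun x hx => ?_
      rw [hS2]; simp only [S2, hx, ↓reduceIte]
    by_cases h4 : n = 4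
    · subst h4
      refine (continuousOn_const (c := a)).congr fun x hx => ?_
      rw [hS4]; simp only [S4, hx, ↓reduceIte]
    exact (continuousOn_const (c := (0:ℝ))).congr fun x _ => hSother n h0 h2 h4 x
  · -- translation invariant
    intro n v x
    by_cases h0 : n = 0
    · subst h0; rfl
    by_cases h2 : n = 2
    · subst h2
      rw [hS2, hS2]
      by_cases hx : x ∈ NonCoincident 3 2
      · simp only [S2, hx, (hmem v x).2 hx, ↓reduceIte, add_sub_add_right_eq_sub]
      · simp only [S2, hx, mt (hmem v x).1 hx, ↓reduceIte]
    by_cases h4 : n = 4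
    · subst h4
      rw [hS4, hS4]
      by_cases hx : x ∈ NonCoincident 3 4
      · simp only [S4, hx, (hmem v x).2 hx, ↓reduceIte]
      · simp only [S4, hx, mt (hmem v x).1 hx, ↓reduceIte]
    rw [hSother n h0 h2 h4, hSother n h0 h2 h4]
  · rw [hS2]; simp only [S2, hx, ↓reduceIte]
  · rw [hS4]; simp only [S4, hx, ↓reduceIte]

/-! ### Two explicit configurations on the axis -/

/-- `e₀ ≠ 0`. [folklore] -/
theorem single_one_ne_zero : (EuclideanSpace.single (0 : Fin 3) (1:ℝ) : EuclideanSpace ℝ (Fin 3)) ≠ 0 := by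
  intro h
  have := congrArg (fun v : EuclideanSpace ℝ (Fin 3) => v 0) h
  simp at this

/-- Real multiples of `e₀` are injective in the coefficient. [folklore] -/
theorem smul_single_injective :
    Function.Injective fun c : ℝ => c • (EuclideanSpace.single (0 : Fin 3) (1:ℝ) : EuclideanSpace ℝ (Fin 3)) :=
  smul_left_injective ℝ single_one_ne_zero

/-- `‖c • e₀‖ = |c|`. [folklore] -/
theorem norm_smul_single (c : ℝ) :
    ‖c • (EuclideanSpace.single (0 : Fin 3) (1:ℝ) : EuclideanSpace ℝ (Fin 3))‖ = |c| := by
  have h1 : ‖(EuclideanSpace.single (0 : Fin 3) (1:ℝ) : EuclideanSpace ℝ (Fin 3))‖ = 1 := by simp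
  rw [norm_smul, h1, mul_one, Real.norm_eq_abs]

/-- The spread configuration `zᵢ = 2i·e₀` is non-coincident and `2`-separated. [folklore] -/
theorem spread_mem :
    (fun i : Fin 4 => (2 * (i : ℝ)) • (EuclideanSpace.single (0 : Fin 3) (1:ℝ) : EuclideanSpace ℝ (Fin 3)))
      ∈ NonCoincident 3 4 := by
  rw [mem_nonCoincident]
  intro i j hij
  have h := smul_single_injective hij
  have : (i : ℝ) = (j : ℝ) := by linarith
  exact Fin.ext (Nat.cast_injective (R := ℝ) this)

/-- Distinct points of the spread configuration are at distance `≥ 2`. [folklore] -/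
theorem spread_sep {i j : Fin 4} (hij : i ≠ j) :
    (2 : ℝ) ≤ ‖(2 * (i : ℝ)) • (EuclideanSpace.single (0 : Fin 3) (1:ℝ) : EuclideanSpace ℝ (Fin 3)) -
      (2 * (j : ℝ)) • EuclideanSpace.single (0 : Fin 3) (1:ℝ)‖ := by
  rw [← sub_smul, norm_smul_single, ← mul_sub, abs_mul, abs_of_pos (by norm_num : (0:ℝ) < 2)]
  have hz : ((i : ℕ) : ℤ) - (j : ℕ) ≠ 0 := by
    intro h
    apply hij
    exact Fin.ext (by omega)
  have h1 : (1 : ℤ) ≤ |((i : ℕ) : ℤ) - (j : ℕ)| := Int.one_le_abs hz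
  have h2 : (1 : ℝ) ≤ |((i : ℕ) : ℝ) - ((j : ℕ) : ℝ)| := by exact_mod_cast h1
  have h3 : |((i : ℕ) : ℝ) - ((j : ℕ) : ℝ)| = |(i : ℝ) - (j : ℝ)| := by norm_cast
  linarith [h3.symm.le, h3.le]

/-- The geometric configuration `xᵢ = 2ⁱ·e₀` is non-coincident, avoids the origin, and has
`∏ ‖xᵢ‖² = 4096`. [folklore] -/
theorem geom_mem :
    (fun i : Fin 4 => ((2:ℝ) ^ (i : ℕ)) • (EuclideanSpace.single (0 : Fin 3) (1:ℝ) : EuclideanSpace ℝ (Fin 3)))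
      ∈ NonCoincident 3 4 := by
  rw [mem_nonCoincident]
  intro i j hij
  have h := smul_single_injective hij
  have h' : (2 : ℕ) ^ (i : ℕ) = 2 ^ (j : ℕ) := by exact_mod_cast h
  exact Fin.ext (Nat.pow_right_injective (le_refl 2) h')

/-- The geometric configuration avoids the origin. [folklore] -/
theorem geom_ne_zero (i : Fin 4) :
    ((2:ℝ) ^ (i : ℕ)) • (EuclideanSpace.single (0 : Fin 3) (1:ℝ) : EuclideanSpace ℝ (Fin 3)) ≠ 0 :=
  smul_ne_zero (pow_ne_zero _ two_ne_zero) single_one_ne_zero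

/-- `∏ᵢ ‖2ⁱ e₀‖² = 4096`. [folklore] -/
theorem geom_prod :
    (∏ i : Fin 4, ‖((2:ℝ) ^ (i : ℕ)) • (EuclideanSpace.single (0 : Fin 3) (1:ℝ) : EuclideanSpace ℝ (Fin 3))‖ ^
      (2 * (1:ℝ))) = 4096 := by
  simp_rw [norm_smul_single, show (2 * (1:ℝ)) = ((2:ℕ) : ℝ) by norm_num, Real.rpow_natCast]
  rw [Fin.prod_univ_four]
  simp
  norm_num

/-! ### STUB 5 without the lattice -/

/-- **`stub_interactingInversion` is FALSE without `IsClusterPoint`.** The regular family `F₁`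
(`S₂ = ‖x−y‖⁻²`, `S₄ = 𝟙_{NonCoincident}`) has `U₄ ≢ 0` but is not inversion covariant with `Δ = 1`.
So the lattice sequence is load-bearing in STUB 5. [folklore] -/
theorem interactingInversion_false_without_clusterPoint :
    ¬ ∀ (Δ : ℝ) (S : CorrFamily 3), MoebiusLimitExistsOnlyInteraction.IsRegular S →
        (∀ x ∈ NonCoincident 3 2, S 2 x = ‖x 0 - x 1‖ ^ (-(2 * Δ))) →
        HasNontrivialU4 S → IsInversionCovariant Δ S := by
  intro h
  obtain ⟨S, hreg, h2, h4⟩ := exists_regular_powerTwo_family 1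
  set e : EuclideanSpace ℝ (Fin 3) := EuclideanSpace.single (0 : Fin 3) (1:ℝ) with he
  -- (1) `U₄ ≢ 0`: at the spread configuration the pairing sum is at most `3/16 < 1 = S₄`
  set z : Fin 4 → EuclideanSpace ℝ (Fin 3) := fun i => (2 * (i : ℝ)) • e with hz
  have hzmem : z ∈ NonCoincident 3 4 := spread_mem
  have hp : ∀ i j : Fin 4, i ≠ j → 0 ≤ S 2 ![z i, z j] ∧ S 2 ![z i, z j] ≤ 1 / 4 := by
    intro i j hij
    have hpair : (![z i, z j] : Fin 2 → EuclideanSpace ℝ (Fin 3)) ∈ NonCoincident 3 2 :=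
      pair_mem_nonCoincident (((mem_nonCoincident z).1 hzmem).ne hij)
    rw [h2 _ hpair]
    simp only [Matrix.cons_val_zero, Matrix.cons_val_one, Matrix.cons_val_fin_one]
    refine ⟨Real.rpow_nonneg (norm_nonneg _) _, ?_⟩
    have hsep : (2:ℝ) ≤ ‖z i - z j‖ := spread_sep hij
    calc ‖z i - z j‖ ^ (-(2 * (1:ℝ))) ≤ (2:ℝ) ^ (-(2 * (1:ℝ))) :=
          Real.rpow_le_rpow_of_nonpos (by norm_num) hsep (by norm_num)
      _ = 1 / 4 := by
          rw [show (-(2 * (1:ℝ))) = -((2:ℕ) : ℝ) by norm_num, Real.rpow_neg (by norm_num), Real.rpow_natCast]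
          norm_num
  have hU : HasNontrivialU4 S := by
    refine ⟨z, hzmem, ?_⟩
    unfold limitConnectedFour
    rw [h4 z hzmem]
    obtain ⟨a01, b01⟩ := hp 0 1 (by decide)
    obtain ⟨a23, b23⟩ := hp 2 3 (by decide)
    obtain ⟨a02, b02⟩ := hp 0 2 (by decide)
    obtain ⟨a13, b13⟩ := hp 1 3 (by decide)
    obtain ⟨a03, b03⟩ := hp 0 3 (by decide)
    obtain ⟨a12, b12⟩ := hp 1 2 (by decide)
    have m1 := mul_le_mul b01 b23 a23 (by norm_num)
    have m2 := mul_le_mul b02 b13 a13 (by norm_num)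
    have m3 := mul_le_mul b03 b12 a12 (by norm_num)
    intro h0
    linarith
  -- (2) inversion covariance with `Δ = 1` fails at the geometric configuration
  have hinv := h 1 S hreg h2 hU
  set x : Fin 4 → EuclideanSpace ℝ (Fin 3) := fun i => ((2:ℝ) ^ (i : ℕ)) • e with hx
  have hxmem : x ∈ NonCoincident 3 4 := geom_mem
  have hcov := hinv 4 x geom_ne_zero
  rw [h4 x hxmem, mul_one] at hcov
  have hprod : (∏ i : Fin 4, ‖x i‖ ^ (2 * (1:ℝ))) = 4096 := geom_prod
  rw [hprod] at hcov
  -- the left-hand side is `1` or `0`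
  have hle : S 4 (fun i => EuclideanGeometry.inversion 0 1 (x i)) ≤ 1 := by
    by_cases hy : (fun i => EuclideanGeometry.inversion 0 1 (x i)) ∈ NonCoincident 3 4
    · rw [h4 _ hy]
    · rw [hreg.1 4 _ hy]; norm_num
  linarith

/-! ### STUB 6 without the lattice -/

/-- **`stub_interactingUnique` is FALSE without `IsClusterPoint`.** The regular families `F₁`, `F₂`
share the pure-power `S₂`, the first is interacting, and they differ at `n = 4`. So the lattice
sequence is load-bearing in STUB 6 too. [folklore] -/
theorem interactingUnique_false_without_clusterPoint :
    ¬ ∀ (Δ : ℝ) (S₁ S₂ : CorrFamily 3), MoebiusLimitExistsOnlyInteraction.IsRegular S₁ →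
        MoebiusLimitExistsOnlyInteraction.IsRegular S₂ →
        (∀ x ∈ NonCoincident 3 2, S₁ 2 x = ‖x 0 - x 1‖ ^ (-(2 * Δ))) →
        (∀ x ∈ NonCoincident 3 2, S₂ 2 x = ‖x 0 - x 1‖ ^ (-(2 * Δ))) →
        HasNontrivialU4 S₁ → ∀ n, (NonCoincident 3 n).EqOn (S₁ n) (S₂ n) := by
  intro h
  -- `F₁` is interacting: reuse the previous proof through STUB 5's negation? No: redo the `U₄` step.
  obtain ⟨S, hreg, h2, h4⟩ := exists_regular_powerTwo_family 1
  obtain ⟨S', hreg', h2', h4'⟩ := exists_regular_powerTwo_family 2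
  set e : EuclideanSpace ℝ (Fin 3) := EuclideanSpace.single (0 : Fin 3) (1:ℝ) with he
  set z : Fin 4 → EuclideanSpace ℝ (Fin 3) := fun i => (2 * (i : ℝ)) • e with hz
  have hzmem : z ∈ NonCoincident 3 4 := spread_mem
  have hp : ∀ i j : Fin 4, i ≠ j → 0 ≤ S 2 ![z i, z j] ∧ S 2 ![z i, z j] ≤ 1 / 4 := by
    intro i j hij
    have hpair : (![z i, z j] : Fin 2 → EuclideanSpace ℝ (Fin 3)) ∈ NonCoincident 3 2 :=
      pair_mem_nonCoincident (((mem_nonCoincident z).1 hzmem).ne hij)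
    rw [h2 _ hpair]
    simp only [Matrix.cons_val_zero, Matrix.cons_val_one, Matrix.cons_val_fin_one]
    refine ⟨Real.rpow_nonneg (norm_nonneg _) _, ?_⟩
    have hsep : (2:ℝ) ≤ ‖z i - z j‖ := spread_sep hij
    calc ‖z i - z j‖ ^ (-(2 * (1:ℝ))) ≤ (2:ℝ) ^ (-(2 * (1:ℝ))) :=
          Real.rpow_le_rpow_of_nonpos (by norm_num) hsep (by norm_num)
      _ = 1 / 4 := by
          rw [show (-(2 * (1:ℝ))) = -((2:ℕ) : ℝ) by norm_num, Real.rpow_neg (by norm_num), Real.rpow_natCast]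
          norm_num
  have hU : HasNontrivialU4 S := by
    refine ⟨z, hzmem, ?_⟩
    unfold limitConnectedFour
    rw [h4 z hzmem]
    obtain ⟨a01, b01⟩ := hp 0 1 (by decide)
    obtain ⟨a23, b23⟩ := hp 2 3 (by decide)
    obtain ⟨a02, b02⟩ := hp 0 2 (by decide)
    obtain ⟨a13, b13⟩ := hp 1 3 (by decide)
    obtain ⟨a03, b03⟩ := hp 0 3 (by decide)
    obtain ⟨a12, b12⟩ := hp 1 2 (by decide)
    have m1 := mul_le_mul b01 b23 a23 (by norm_num)
    have m2 := mul_le_mul b02 b13 a13 (by norm_num)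
    have m3 := mul_le_mul b03 b12 a12 (by norm_num)
    intro h0
    linarith
  have heq := h 1 S S' hreg hreg' h2 h2' hU 4 hzmem
  rw [h4 z hzmem, h4' z hzmem] at heq
  norm_num at heq

end Summit.CriticalPhenomena.Ising3DConformalLimit.MoebiusLimitExistsNegative

end
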